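import Summits.BirchSwinnertonDyer.BirchSwinnertonDyer.Theorems.PrintCf2RamifiedOffTYZMoverCoordinates
import HarnessLib

/-!
# Crux `PrintCf2.RamifiedOffTYZOfFacts` (stmt-BirchSwinnertonDyer-20509), line `offtyz-v7`, LEAD cycle 9 (cruxlead-20509 g8):
# BIT SURJECTIVITY FROM GALOIS THEORY ALONE — every sign pattern on `i, i√−q₁, …, i√−q_m` is realised by an automorphism of `ℍ′_n`

THEOREMS ONLY (no `def`, no named fact, no `sorry`), `--supports stmt-BirchSwinnertonDyer-20509`.  The input (b) of the LEAD g7's `n ≡ 7 (mod 8)`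
mover assembly (`Cruxes/RamifiedOffTYZOfFacts/Lines/offtyz_v7_MoverAssembly.md` §6): for the FULL prime set of `n ≡ 7 (mod 8)` the typed displays
carry no ring class dictionary (g7 obtained the bit surjectivity on a block `d ≡ 5 (mod 8)` from `Pic(𝒪₂)` and Gauss's count,
`…MoverCoordinates.exists_mem_galK_bits_eq`).  Here it is proved for EVERY square-free `n` and every tuple of distinct prime divisors
`q₁, …, q_m`, with no class field theory: **`exists_aut_im_bits_eq`** — for every `(v₀; v) ∈ 𝔽₂^{1+m}` there is `g ∈ Aut_ℚ(ℍ′_n)` with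
`[g moves i] = v₀` and `[g moves i·√−q_j] = v_j` — and **`exists_mem_galK_bits_eq_of_prod`** — for `d = ∏ q_j ∣ n` and every `v ∈ 𝔽₂^m` there
is `g ∈ Gal(ℍ′_n/K_d)` with prime bits `v`.
PROOF.  The bit map `g ↦ ([g moves u_t])_t` (`u₀ = i`, `u_j = i√−q_j`; each `u_t` is a non-zero `±`-eigenvector of every `g`) is a homomorphism
`Aut_ℚ(ℍ′_n) → 𝔽₂^{1+m}`; its image `W` is an `𝔽₂`-subspace.  If `W ≠ 𝔽₂^{1+m}`, a non-zero linear functional `(x₀; x) ↦ ε x₀ + Σ_{j∈S} x_j`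
(`ε = 1` or `S ≠ ∅`) kills `W` (`Submodule.exists_dual_map_eq_bot_of_lt_top`), i.e. every `g` fixes `u := i^ε · ∏_{j∈S} i√−q_j` (sign bits are
additive over products); `ℍ′_n/ℚ` being Galois, `u ∈ ℚ` (`IsGalois.mem_bot_iff_fixed`); but `u² = (−1)^ε · ∏_{j∈S} q_j` is not the square of a
rational (negative, or a square-free integer `> 1`).  Pure Galois theory + unique factorisation; BSD is not proved by any of this; no class is
closed by this file.

References: [cite: TianYuanZhang2017, §3.1 (p0011 L60–L64: `K_d ⊂ L_n(i) ⊂ ℍ′_n`) and proof of Lemma 3.21 (p0020 L55–L58: `L_n(i) = ℚ(i, √d : d ∣ n)`)];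
[cite: Cox2013, §6.A (genus field), Thm. 6.1]; Kummer theory of exponent 2 over ℚ [folklore].
-/

noncomputable section

open scoped Classical NumberField

open WeierstrassCurve WeierstrassCurve.Affine Finset Literature.NumberTheory.EllipticCurves
  Literature.NumberTheory.EllipticCurves.TianYuanZhang2017
  Literature.NumberTheory.EllipticCurves.HeathBrown1994

set_option autoImplicit false

namespace Summit.BirchSwinnertonDyer.PrintCf2.MoverAssembly

/-! ## §1 Arithmetic: a signed product of distinct primes is not a square -/

section Arithmetic

variable {m : ℕ} (q : Fin m → ℕ) (hq : ∀ j, (q j).Prime) (hqinj : Function.Injective q)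

include hq hqinj in
/-- A product of DISTINCT primes over a nonempty index set is not a square (it is square-free and `> 1`). [folklore] -/
theorem not_isSquare_prod_primes {S : Finset (Fin m)} (hS : S.Nonempty) : ¬ IsSquare (∏ j ∈ S, (q j : ℤ)) := by
  rw [← Nat.cast_prod, Int.isSquare_natCast_iff]
  rintro ⟨s, hs⟩
  have hsf : Squarefree (∏ j ∈ S, q j) :=
    (squarefree_prod_of_injective q hq hqinj).squarefree_of_dvd (prod_dvd_prod_of_subset S univ q (subset_univ S))
  rw [hs] at hsf
  have hs1 : s = 1 := Nat.isUnit_iff.mp (hsf s (dvd_refl _))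
  obtain ⟨j, hj⟩ := hS
  have hdvd : q j ∣ ∏ j ∈ S, q j := dvd_prod_of_mem q hj
  rw [hs, hs1, mul_one, Nat.dvd_one] at hdvd
  exact (hq j).one_lt.ne' hdvd

include hq hqinj in
/-- **`(−1)^ε · ∏_{j ∈ S} q_j` is not a square** when `ε = 1` or `S ≠ ∅` (negative, or a square-free integer `> 1`). [folklore] -/
theorem not_isSquare_signedProd {ε : ZMod 2} {S : Finset (Fin m)} (hεS : ε = 1 ∨ S.Nonempty) :
    ¬ IsSquare ((if ε = 1 then (-1 : ℤ) else 1) * ∏ j ∈ S, (q j : ℤ)) := by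
  by_cases hε : ε = 1
  · rw [if_pos hε]
    rintro ⟨s, hs⟩
    have hpos : 0 < ∏ j ∈ S, (q j : ℤ) := prod_pos fun j _ => by exact_mod_cast (hq j).pos
    nlinarith [mul_self_nonneg s]
  · rw [if_neg hε, one_mul]
    exact not_isSquare_prod_primes q hq hqinj (hεS.resolve_left hε)

end Arithmetic

/-! ## §2 Every sign pattern is an automorphism -/

variable {n : ℕ} (D : GenusPointData n)
variable {m : ℕ} (q : Fin m → ℕ) (hq : ∀ j, (q j).Prime) (hqinj : Function.Injective q)

include hq hqinj in
/-- **BIT SURJECTIVITY** (Kummer theory of exponent `2` over `ℚ`, via Galois theory inside `ℍ′_n`): for distinct prime divisors `q₁, …, q_m` of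
`n` and every `(v₀; v) ∈ 𝔽₂^{1+m}` there is `g ∈ Aut_ℚ(ℍ′_n)` with `[g moves i] = v₀` and `[g moves i·√−q_j] = v_j` for all `j`.  The image of the
bit homomorphism is a subspace of `𝔽₂^{1+m}`; a non-zero functional killing it would make a product of the generators `Aut`-invariant, hence
rational (`ℍ′_n/ℚ` Galois), while its square is not a rational square (§1).
[cite: TianYuanZhang2017, proof of Lemma 3.21 (p0020 L55–L58)] [cite: Cox2013, Thm. 6.1] -/
theorem exists_aut_im_bits_eq (hqn : ∀ j, q j ∈ n.divisors) (v₀ : ZMod 2) (v : Fin m → ZMod 2) :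
    ∃ g : D.H ≃ₐ[ℚ] D.H, (if g D.im = D.im then (0 : ZMod 2) else 1) = v₀ ∧
      ∀ j, (if g (D.im * D.sqrtNeg (q j)) = D.im * D.sqrtNeg (q j) then (0 : ZMod 2) else 1) = v j := by
  set gen : Option (Fin m) → D.H := fun t => Option.elim t D.im (fun j => D.im * D.sqrtNeg (q j)) with hgen
  -- each generator is a non-zero `±`-eigenvector of every automorphism
  have hgen_or : ∀ (g : D.H ≃ₐ[ℚ] D.H) (t : Option (Fin m)),
      (g : D.H →+* D.H) (gen t) = gen t ∨ (g : D.H →+* D.H) (gen t) = -gen t := by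
    intro g t
    rcases t with _ | j
    · exact apply_im_eq_or D g
    · exact apply_im_mul_sqrtNeg_eq_or D g (hqn j)
  have hgen_ne : ∀ t : Option (Fin m), gen t ≠ 0 := by
    intro t
    rcases t with _ | j
    · exact D.im_ne_zero
    · exact im_mul_sqrtNeg_ne_zero D (hqn j)
  -- the bit map is a homomorphism to `𝔽₂^{1+m}`
  set b : (D.H ≃ₐ[ℚ] D.H) → (Option (Fin m) → ZMod 2) :=
    fun g t => if (g : D.H →+* D.H) (gen t) = gen t then 0 else 1 with hb
  have hb_one : b 1 = 0 := by
    funext t; exact if_pos rfl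
  have hb_mul : ∀ g h : D.H ≃ₐ[ℚ] D.H, b (g * h) = b g + b h := by
    intro g h
    funext t
    exact bit_comp (g : D.H →+* D.H) (h : D.H →+* D.H) (hgen_or g t) (hgen_or h t) (hgen_ne t)
  -- its image is an `𝔽₂`-subspace
  let W : Submodule (ZMod 2) (Option (Fin m) → ZMod 2) :=
    { carrier := Set.range b
      add_mem' := by
        rintro _ _ ⟨g, rfl⟩ ⟨h, rfl⟩
        exact ⟨g * h, hb_mul g h⟩
      zero_mem' := ⟨1, hb_one⟩
      smul_mem' := by
        rintro c _ ⟨g, rfl⟩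
        rcases (by decide : ∀ c : ZMod 2, c = 0 ∨ c = 1) c with rfl | rfl
        · exact ⟨1, by rw [zero_smul, hb_one]⟩
        · exact ⟨g, by rw [one_smul]⟩ }
  suffices hW : W = ⊤ by
    have hv : (fun t => Option.elim t v₀ v) ∈ W := by rw [hW]; exact Submodule.mem_top
    obtain ⟨g, hg⟩ := hv
    exact ⟨g, congr_fun hg none, fun j => congr_fun hg (some j)⟩
  by_contra hW
  obtain ⟨f, hf0, hfW⟩ := Submodule.exists_dual_map_eq_bot_of_lt_top (lt_top_iff_ne_top.mpr hW) inferInstance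
  -- `f` kills the image
  have hfb : ∀ g : D.H ≃ₐ[ℚ] D.H, f (b g) = 0 := by
    intro g
    have h : f (b g) ∈ W.map f := Submodule.mem_map_of_mem ⟨g, rfl⟩
    rw [hfW, Submodule.mem_bot] at h
    exact h
  -- coordinates of `f`: `f x = Σ_t x_t c_t`
  set c : Option (Fin m) → ZMod 2 := fun t => f (fun s => if t = s then 1 else 0) with hc
  have hfx : ∀ x : Option (Fin m) → ZMod 2, f x = ∑ t, x t * c t := by
    intro x
    rw [LinearMap.pi_apply_eq_sum_univ f x]
    rfl
  have h01 : ∀ u : ZMod 2, u ≠ 1 → u = 0 := by decide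
  -- `c ≠ 0`
  have hcne : ∃ t, c t = 1 := by
    by_contra h
    push Not at h
    refine hf0 (LinearMap.ext fun x => ?_)
    rw [hfx, LinearMap.zero_apply]
    exact sum_eq_zero fun t _ => by rw [h01 _ (h t), mul_zero]
  -- the support: `ε = c none`, `S = {j : c (some j) = 1}`
  set ε : ZMod 2 := c none with hε
  set S : Finset (Fin m) := univ.filter (fun j => c (some j) = 1) with hS
  have hεS : ε = 1 ∨ S.Nonempty := by
    obtain ⟨t, ht⟩ := hcne
    rcases t with _ | j
    · exact Or.inl ht
    · exact Or.inr ⟨j, by rw [hS, mem_filter]; exact ⟨mem_univ j, ht⟩⟩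
  -- the test element `u = i^ε · ∏_{j ∈ S} i√−q_j`
  set w : D.H := if ε = 1 then D.im else 1 with hw
  have hw_or : ∀ g : D.H ≃ₐ[ℚ] D.H, (g : D.H →+* D.H) w = w ∨ (g : D.H →+* D.H) w = -w := by
    intro g
    by_cases h1 : ε = 1
    · rw [hw, if_pos h1]; exact apply_im_eq_or D g
    · rw [hw, if_neg h1]; exact Or.inl (map_one _)
  have hw_ne : w ≠ 0 := by
    by_cases h1 : ε = 1
    · rw [hw, if_pos h1]; exact D.im_ne_zero
    · rw [hw, if_neg h1]; exact one_ne_zero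
  have hw_bit : ∀ g : D.H ≃ₐ[ℚ] D.H, (if (g : D.H →+* D.H) w = w then (0 : ZMod 2) else 1) =
      (if (g : D.H →+* D.H) D.im = D.im then (0 : ZMod 2) else 1) * ε := by
    intro g
    by_cases h1 : ε = 1
    · rw [hw, if_pos h1, h1, mul_one]
    · rw [hw, if_neg h1, if_pos (map_one _), h01 _ h1, mul_zero]
  have hw_sq : w ^ 2 = ((if ε = 1 then (-1 : ℤ) else 1 : ℤ) : D.H) := by
    by_cases h1 : ε = 1
    · rw [hw, if_pos h1, if_pos h1, D.im_sq]; push_cast; rfl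
    · rw [hw, if_neg h1, if_neg h1, one_pow]; push_cast; rfl
  have hP_or : ∀ g : D.H ≃ₐ[ℚ] D.H, ((g : D.H →+* D.H) (∏ j ∈ S, D.im * D.sqrtNeg (q j)) = ∏ j ∈ S, D.im * D.sqrtNeg (q j) ∨
      (g : D.H →+* D.H) (∏ j ∈ S, D.im * D.sqrtNeg (q j)) = -∏ j ∈ S, D.im * D.sqrtNeg (q j)) ∧
      (if (g : D.H →+* D.H) (∏ j ∈ S, D.im * D.sqrtNeg (q j)) = ∏ j ∈ S, D.im * D.sqrtNeg (q j) then (0 : ZMod 2) else 1) =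
        ∑ j ∈ S, (if (g : D.H →+* D.H) (D.im * D.sqrtNeg (q j)) = D.im * D.sqrtNeg (q j) then (0 : ZMod 2) else 1) :=
    fun g => bit_prod (g : D.H →+* D.H) S (fun j => D.im * D.sqrtNeg (q j)) (fun j _ => apply_im_mul_sqrtNeg_eq_or D g (hqn j))
      (fun j _ => im_mul_sqrtNeg_ne_zero D (hqn j))
  have hP_ne : ∏ j ∈ S, D.im * D.sqrtNeg (q j) ≠ 0 := prod_ne_zero_iff.mpr fun j _ => im_mul_sqrtNeg_ne_zero D (hqn j)
  set u : D.H := w * ∏ j ∈ S, D.im * D.sqrtNeg (q j) with hu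
  -- `u` is fixed by every automorphism
  have hfix : ∀ g : D.H ≃ₐ[ℚ] D.H, g u = u := by
    intro g
    have hbit : (if (g : D.H →+* D.H) u = u then (0 : ZMod 2) else 1) = f (b g) := by
      rw [hu, bit_mul (g : D.H →+* D.H) (hw_or g) (hP_or g).1 hw_ne hP_ne, hw_bit g, (hP_or g).2, hfx, Fintype.sum_option,
        hS, sum_filter]
      congr 1
      refine sum_congr rfl fun j _ => ?_
      by_cases hcj : c (some j) = 1
      · rw [if_pos hcj, hcj, mul_one, hb, hgen]
        rfl
      · rw [if_neg hcj, h01 _ hcj, mul_zero]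
    rw [hfb g] at hbit
    by_contra hne
    exact one_ne_zero ((if_neg hne).symm.trans hbit)
  -- hence `u` is rational
  obtain ⟨r, hr⟩ : ∃ r : ℚ, algebraMap ℚ D.H r = u :=
    IntermediateField.mem_bot.mp ((IsGalois.mem_bot_iff_fixed u).mpr hfix)
  -- but `u² = (−1)^ε ∏_S q_j` is not a square
  have husq : u ^ 2 = (((if ε = 1 then (-1 : ℤ) else 1) * ∏ j ∈ S, (q j : ℤ) : ℤ) : D.H) := by
    rw [hu, mul_pow, hw_sq, ← prod_pow, prod_congr rfl (fun j _ => im_mul_sqrtNeg_sq D (hqn j))]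
    push_cast
    rfl
  have hAsq : IsSquare ((if ε = 1 then (-1 : ℤ) else 1) * ∏ j ∈ S, (q j : ℤ)) := by
    have h2 : algebraMap ℚ D.H (r ^ 2) = algebraMap ℚ D.H (((if ε = 1 then (-1 : ℤ) else 1) * ∏ j ∈ S, (q j : ℤ) : ℤ) : ℚ) := by
      rw [map_pow, hr, husq, map_intCast]
    have h3 := (algebraMap ℚ D.H).injective h2
    exact Rat.isSquare_intCast_iff.mp ⟨r, by rw [← h3, sq]⟩
  exact not_isSquare_signedProd q hq hqinj hεS hAsq

include hq hqinj in
/-- **Bit surjectivity on `Gal(ℍ′_n/K_d)`** for a block `d = ∏ q_j ∣ n` (ANY residue of `d`; no ring class dictionary): for every `v ∈ 𝔽₂^m`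
there is `g` fixing `√−d` with `[g moves i·√−q_j] = v_j` (take `[g moves i] = Σ_j v_j`, so that `[g moves √−d] = [g moves i] + Σ_j v_j = 0`).
Supersedes the dictionary-based `exists_mem_galK_bits_eq` (blocks `d ≡ 5 (mod 8)`) and supplies input (b) of the `n ≡ 7 (mod 8)` assembly.
[cite: TianYuanZhang2017, §3.1 (p0011 L60–L64) and proof of Lemma 3.21 (p0020 L55–L58)] [cite: Cox2013, Thm. 6.1] -/
theorem exists_mem_galK_bits_eq_of_prod (hqn : ∀ j, q j ∈ n.divisors) {d : ℕ} (hd : d ∈ n.divisors) (hprod : ∏ j, q j = d)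
    (v : Fin m → ZMod 2) :
    ∃ g : D.H ≃ₐ[ℚ] D.H, g (D.sqrtNeg d) = D.sqrtNeg d ∧
      ∀ j, (if g (D.im * D.sqrtNeg (q j)) = D.im * D.sqrtNeg (q j) then (0 : ZMod 2) else 1) = v j := by
  obtain ⟨g, hg0, hg⟩ := exists_aut_im_bits_eq D q hq hqinj hqn (∑ j, v j) v
  refine ⟨g, ?_, hg⟩
  have h := bit_sqrtNeg_eq_bit_im_add_sum D q hd hprod g
  rw [hg0] at h
  simp only [hg] at h
  rw [CharTwo.add_self_eq_zero] at h
  by_contra hne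
  rw [if_neg hne] at h
  exact one_ne_zero h

end Summit.BirchSwinnertonDyer.PrintCf2.MoverAssembly

end
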